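import Literature.MathematicalPhysics.QuantumFieldTheory.Balaban1983to89.B3CxiComparisonBound
import Literature.MathematicalPhysics.QuantumFieldTheory.Balaban1983to89.B3TorusRadialSums
import HarnessLib

/-!
# B3 — T. Bałaban, *(Higgs)₂,₃ quantum fields in a finite volume. III. Renormalization*, CMP **88** (1983) 411–445
[Balaban1983Higgs3], p. 437 [PDF 27]: the printed bound **|C^ξ(y − y′)| ≦ O(1)e^{−½|y−y′|}/|y − y′|** — TORUS MEMBER:
the free propagator C^ξ_T = (−Δ^ξ + 1)^{−1} of the periodic ξ-lattice T^{(j)}_ξ (`Balaban1983to89.Site P j`, d = 3),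
constructed by PERIODIZATION of the ξℤ³ propagator and PROVED to satisfy exactly the hypothesis `hC` of seat p20's
`B3Bound316.abs_bracket316_le` (δ = ½, |y − y′| = ξ·`supDist y y′`), uniformly in 0 < ξ ≤ 1 and in the torus as long as its
physical period ξ·N is ≥ 1

statement-level skeleton of published theorems with citation tags; proofs where landed; nothing here is a claim about
the Yang–Mills mass gap

PDF held: `paper:balaban1983-higgs-2-3-quantum-fields-finite-volume` (journal page = PDF page + 410).  Read: p. 437 [PDF 27] on
the ×2 render `run/shared/lean/pub/pub-balaban/b2b-balaban-ref1/pages/1983-cmp88-higgs23-III/1983-cmp88-higgs23-III-p027-x2.png`.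

CITATION HEADER (lean-in-tree rule).  Part of the lit-balaban TYPED SKELETON (HOME `run/shared/lean/pub/lit-balaban/`), Phase-2
proof seat p03, generation 3 (unit `lit-balaban-p03-g3`; TAKING line HOME/STATUS.md 2026-08-21T05:46Z), file 2 of 2 (file 1 =
`B3CxiComparisonBound`, the comparison-principle proof of the bound on ξℤ³).  Row served: **B3.Eq3.11-3.17** of
`HOME/lit-balaban-r15/ROWS-B3.md` (owner r15), the p. 437 sentence *"Using the inequalities |C^ξ(y − y′)| ≦ O(1)e^{−½|y−y′|}/|y − y′|,
|G^ξ_{j″}(0; y, y′)| ≦ O(1)e^{−δ₀|y−y′|}/|y−y′|, and the corresponding inequalities for derivatives, we can estimate (3.16) by a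
constant"*, whose C^ξ-inequality enters seat p20's PROVED estimate of (3.16) (`B3Bound316.abs_bracket316_le`,
`B3Ineq313Pointwise`) as the HYPOTHESIS
`hC : ∀ y y′ : Site P j, y′ ≠ y → |C y y′| ≤ A * (ξ * supDist y y′)⁻¹ * Real.exp (-(δ * (ξ * supDist y y′)))` on an abstract
`Kernel P j`.  THIS FILE discharges that hypothesis for the ACTUAL periodic free propagator (theorem `CxiT_hC`).  Theorem of
record for the bound on the infinite lattice ξℤ³: seat p39 gen 3 (`B3CxiBesselKernel`/`B3CxiPoissonization`/`B3CxiUniformBound`);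
the input used here is this seat's independent witness `B3CxiComparisonBound.abs_Cxi_le_yukawa_sup`.

WHAT IS DEFINED AND PROVED (`N = P.sitesPerDir j` sites per direction; integer site coordinates; C^ξ = r15's
`B3Sect3VectorSelfEnergy.Cxi d ξ`, a kernel with respect to Σ_{y′}ξ^d).
* §1  COSET SUMS on ℤ^d (any d): `cosetPt N z n = z + N·n`, `perCxi d ξ N z = Σ'_{n ∈ ℤ^d} C^ξ(z + N·n)` (summable by r15's
  `summable_Cxi`), invariance under z ↦ z + N·w (`perCxi_add_smul`, `perCxi_congr`), and the lattice equation of the periodization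
  `negLapZ_perCxi_add`: (−Δ^ξ + 1)(perCxi)(z) = Σ'_n ξ^{−d}[z + N·n = 0] (termwise from r15's `negLapZ_Cxi_add`).
* §2  THE TORUS PROPAGATOR `CxiT ξ : Kernel P j`, `CxiT ξ y y′ = perCxi (P.d) ξ N (liftZ y y′)` with `liftZ` the coordinatewise
  minimal representative (`ZMod.valMinAbs`) of y − y′; it depends on y − y′ only (`CxiT_shift_shift`), is ≥ 0, and IS the kernel of
  (−Δ^ξ_T + 1)^{−1} for the volume element ξ^d: **`laplace_CxiT_add`**: `laplace ξ⁻¹ (CxiT ξ · y′) y + CxiT ξ y y′ = ξ^{−d}[y = y′]`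
  (tree's `LatticeFieldCalculus.laplace` = −Δ^ξ), and in operator form **`laplace_kernelOp_CxiT_add`**:
  `laplace ξ⁻¹ (kernelOp ξ^d (CxiT ξ) f) + kernelOp ξ^d (CxiT ξ) f = f` — the hypothesis `hC` of p20's `eq316_sum_pdiff`.
* §3  THE BOUND (d = 3): for 0 < ξ ≤ 1 and ξ·N ≥ 1, **`abs_CxiT_le` / `CxiT_hC`**:
  `|CxiT ξ y y′| ≤ torusConst * (ξ * supDist y y′)⁻¹ * exp (−(1/2 * (ξ * supDist y y′)))` for y′ ≠ y, with the absolute constant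
  `torusConst = cmpConst · (1 + 2/(1 − e^{−1/6}))³`.  Proof: each coset term is bounded by `abs_Cxi_le_yukawa_sup` at the point
  z + N·n, whose sup norm is ≥ |z|_∞ and ≥ |z|_∞ + N(|n_μ| − 1) in every direction with n_μ ≠ 0 (|z_μ| ≤ N/2 for the minimal
  representative); hence term ≤ (A e^{−½ξ|z|_∞}/(ξ|z|_∞))·Π_μ q^{(|n_μ|−1)⁺}, q = e^{−ξN/6} ≤ e^{−1/6}, and
  Σ_{n∈ℤ³}Π_μ q^{(|n_μ|−1)⁺} = (1 + 2/(1−q))³ (`sum_prod_le`).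
The hypothesis ξ·N ≥ 1 (physical period at least one; for N = 2L^{m+K−j} and ξ = L^{−j″} it reads j + j″ ≤ m + K) cannot be
dropped: Σ_{y′} ξ³·CxiT ξ y y′ = 1 (zero mode, §4 `sum_mul_CxiT` from r15's `tsum_Cxi`), so C^ξ_T(y, y′) ≥ (ξN)^{−3} for some y′
(`exists_CxiT_ge`) and no bound uniform in the period is possible.
* §4 (v1.1, append-only, theorems only)  symmetry `CxiT_symm` (C^ξ even, `perCxi_neg`), the bijection T × ℤ^d → ℤ^d
  (y′, n) ↦ (ỹ − ỹ′) + N·n (`cosetPt_liftZ_bijective`), UNIT MASS `sum_mul_CxiT`: Σ_{y′} ξ^d C^ξ_T(y, y′) = 1, and the zero-mode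
  lower bound `exists_CxiT_ge`: ∃ y′, C^ξ_T(y, y′) ≥ (ξN)^{−d}.
Nothing of [Balaban1983Higgs3] beyond the quoted inequality is asserted; no `def … : Prop`; axioms standard.  Unit
`lit-balaban-p03` (literature-prover-lit-balaban-p03-g3-0), 2026-08-21 (v1 p251987; v1.1 same day).
-/

open scoped BigOperators
open Real Set

namespace Literature.MathematicalPhysics.QuantumFieldTheory.Balaban1983to89.B3CxiTorusBound

open B3Sect3VectorSelfEnergy B3CxiPropagator B3CxiComparisonBound B3Sect3ScalarSelfEnergy B3TorusRadialSums
  LatticeFieldCalculus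

noncomputable section

/-! ## 1. Coset sums on ℤ^d: the periodization of C^ξ -/

section Coset

variable {d : ℕ}

/-- the point z + N·n of the coset z + Nℤ^d. [cite: Balaban1983Higgs3, (3.16) p.437] -/
def cosetPt (N : ℕ) (z n : ZSite d) : ZSite d := z + (N : ℤ) • n

/-- kernel: coordinates of a coset point. [cite: Balaban1983Higgs3, (3.16) p.437] -/
theorem cosetPt_apply (N : ℕ) (z n : ZSite d) (μ : Fin d) : cosetPt N z n μ = z μ + N * n μ := by
  simp [cosetPt]

/-- kernel: n ↦ z + N·n is injective (N ≠ 0). [cite: Balaban1983Higgs3, (3.16) p.437] -/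
theorem cosetPt_injective {N : ℕ} (hN : N ≠ 0) (z : ZSite d) : Function.Injective (cosetPt N z) := by
  intro n n' h
  funext μ
  have h1 := congr_fun h μ
  simp only [cosetPt_apply] at h1
  have hN' : (N : ℤ) ≠ 0 := by exact_mod_cast hN
  exact mul_left_cancel₀ hN' (by linarith)

/-- kernel: C^ξ restricted to a coset is summable (r15's `summable_Cxi`). [cite: Balaban1983Higgs3, (3.16) p.437] -/
theorem summable_coset {ξ : ℝ} (hξ : 0 < ξ) {N : ℕ} (hN : N ≠ 0) (z : ZSite d) :
    Summable fun n : ZSite d => Cxi d ξ (cosetPt N z n) :=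
  (summable_Cxi (d := d) hξ).comp_injective (cosetPt_injective hN z)

/-- The PERIODIZATION of C^ξ with period N: Σ'_{n ∈ ℤ^d} C^ξ(z + N·n). [cite: Balaban1983Higgs3, (3.16) p.437] -/
def perCxi (d : ℕ) (ξ : ℝ) (N : ℕ) (z : ZSite d) : ℝ := ∑' n : ZSite d, Cxi d ξ (cosetPt N z n)

/-- kernel: the periodization is nonnegative. [cite: Balaban1983Higgs3, (3.16) p.437] -/
theorem perCxi_nonneg {ξ : ℝ} (hξ : 0 < ξ) (N : ℕ) (z : ZSite d) : 0 ≤ perCxi d ξ N z :=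
  tsum_nonneg fun _ => Cxi_nonneg hξ _

/-- kernel: the periodization is N-periodic. [cite: Balaban1983Higgs3, (3.16) p.437] -/
theorem perCxi_add_smul (ξ : ℝ) (N : ℕ) (z w : ZSite d) : perCxi d ξ N (z + (N : ℤ) • w) = perCxi d ξ N z := by
  unfold perCxi
  have h : ∀ n, cosetPt N (z + (N : ℤ) • w) n = cosetPt N z (w + n) := by
    intro n; simp only [cosetPt, smul_add]; abel
  simp_rw [h]
  exact (Equiv.addLeft w).tsum_eq (fun n => Cxi d ξ (cosetPt N z n))

/-- kernel: the periodization depends only on the residues of the coordinates mod N. [cite: Balaban1983Higgs3, (3.16) p.437] -/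
theorem perCxi_congr (ξ : ℝ) {N : ℕ} {z z' : ZSite d} (h : ∀ μ, ((z μ : ℤ) : ZMod N) = ((z' μ : ℤ) : ZMod N)) :
    perCxi d ξ N z = perCxi d ξ N z' := by
  have hw : ∀ μ, ∃ w : ℤ, z μ = z' μ + N * w := by
    intro μ
    obtain ⟨w, hw⟩ := (ZMod.intCast_eq_intCast_iff_dvd_sub (z' μ) (z μ) N).1 (h μ).symm
    exact ⟨w, by linarith⟩
  choose w hw using hw
  have hz : z = z' + (N : ℤ) • (fun μ => w μ) := by
    funext μ; simp [hw μ]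
  rw [hz, perCxi_add_smul]

/-- **The lattice equation of the periodization**: (−Δ^ξ + 1)(Σ'_n C^ξ(· + N·n))(z) = Σ'_n ξ^{−d}[z + N·n = 0] on ℤ^d (termwise,
r15's `negLapZ_Cxi_add`). [cite: Balaban1983Higgs3, (3.16) p.437] -/
theorem negLapZ_perCxi_add {ξ : ℝ} (hξ : 0 < ξ) {N : ℕ} (hN : N ≠ 0) (z : ZSite d) :
    negLapZ ξ (perCxi d ξ N) z + perCxi d ξ N z =
      ∑' n : ZSite d, (if cosetPt N z n = 0 then ξ⁻¹ ^ d else 0) := by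
  set x : ZSite d → ZSite d := cosetPt N z with hx
  have ha : Summable fun n => Cxi d ξ (x n) := summable_coset hξ hN z
  have hb : ∀ μ : Fin d, Summable fun n => Cxi d ξ (x n + unitVec μ) := by
    intro μ
    have h := summable_coset (d := d) hξ hN (z + unitVec μ)
    refine h.congr fun n => ?_
    simp only [hx, cosetPt]; congr 1; abel
  have hc : ∀ μ : Fin d, Summable fun n => Cxi d ξ (x n - unitVec μ) := by
    intro μ
    have h := summable_coset (d := d) hξ hN (z - unitVec μ)
    refine h.congr fun n => ?_
    simp only [hx, cosetPt]; congr 1; abel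
  have hpb : ∀ μ : Fin d, perCxi d ξ N (z + unitVec μ) = ∑' n, Cxi d ξ (x n + unitVec μ) := by
    intro μ; unfold perCxi; congr 1; funext n; simp only [hx, cosetPt]; congr 1; abel
  have hpc : ∀ μ : Fin d, perCxi d ξ N (z - unitVec μ) = ∑' n, Cxi d ξ (x n - unitVec μ) := by
    intro μ; unfold perCxi; congr 1; funext n; simp only [hx, cosetPt]; congr 1; abel
  have hsum : HasSum (fun n => ∑ μ : Fin d, ξ⁻¹ ^ 2 * (2 * Cxi d ξ (x n) - Cxi d ξ (x n + unitVec μ) - Cxi d ξ (x n - unitVec μ))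
      + Cxi d ξ (x n)) (∑ μ : Fin d, ξ⁻¹ ^ 2 * (2 * (∑' n, Cxi d ξ (x n)) - (∑' n, Cxi d ξ (x n + unitVec μ))
      - ∑' n, Cxi d ξ (x n - unitVec μ)) + ∑' n, Cxi d ξ (x n)) :=
    (hasSum_sum fun μ _ => (((ha.hasSum.mul_left 2).sub (hb μ).hasSum).sub (hc μ).hasSum).mul_left (ξ⁻¹ ^ 2)).add
      ha.hasSum
  have hL : negLapZ ξ (perCxi d ξ N) z + perCxi d ξ N z = ∑ μ : Fin d, ξ⁻¹ ^ 2 * (2 * (∑' n, Cxi d ξ (x n))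
      - (∑' n, Cxi d ξ (x n + unitVec μ)) - ∑' n, Cxi d ξ (x n - unitVec μ)) + ∑' n, Cxi d ξ (x n) := by
    simp only [negLapZ, hpb, hpc]
    rfl
  rw [hL, ← hsum.tsum_eq]
  refine tsum_congr fun n => ?_
  have h := negLapZ_Cxi_add (d := d) hξ (x n)
  simp only [negLapZ] at h
  rw [h]

/-- kernel: the source of the periodized equation when the coset contains 0. [cite: Balaban1983Higgs3, (3.16) p.437] -/
theorem tsum_ite_cosetPt_of_mem {N : ℕ} (hN : N ≠ 0) {z n₀ : ZSite d} (h0 : cosetPt N z n₀ = 0) (c : ℝ) :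
    ∑' n : ZSite d, (if cosetPt N z n = 0 then c else 0) = c := by
  rw [tsum_eq_single n₀ fun n hn => if_neg fun h => hn (cosetPt_injective hN z (h.trans h0.symm))]
  exact if_pos h0

/-- kernel: the source vanishes when the coset misses 0. [cite: Balaban1983Higgs3, (3.16) p.437] -/
theorem tsum_ite_cosetPt_of_not_mem {N : ℕ} {z : ZSite d} (h0 : ∀ n, cosetPt N z n ≠ 0) (c : ℝ) :
    ∑' n : ZSite d, (if cosetPt N z n = 0 then c else 0) = 0 := by
  simp [h0]

end Coset

/-! ## 2. The free propagator of the torus T^{(j)}_ξ and its equation -/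

section Torus

variable {P : Params} {j : ℕ}

/-- the minimal integer representative of y − y′, coordinatewise (`ZMod.valMinAbs`, values in (−N/2, N/2]).
[cite: Balaban1983Higgs3, (3.16) p.437] -/
def liftZ (y y' : Site P j) : ZSite P.d := fun μ => (y μ - y' μ).valMinAbs

/-- **THE FREE PROPAGATOR OF THE TORUS** C^ξ_T(y, y′) = Σ_{n ∈ ℤ^d} C^ξ(ỹ − ỹ′ + N·n): the kernel (with respect to Σ_{y′}ξ^d) of
(−Δ^ξ_T + 1)^{−1} on the periodic lattice with N = `P.sitesPerDir j` sites per direction (`laplace_CxiT_add`).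
[cite: Balaban1983Higgs3, (3.16) p.437] -/
def CxiT (ξ : ℝ) : Kernel P j := fun y y' => perCxi P.d ξ (P.sitesPerDir j) (liftZ y y')

/-- kernel: the representative reduces to y − y′. [cite: Balaban1983Higgs3, (3.16) p.437] -/
theorem liftZ_cast (y y' : Site P j) (μ : Fin P.d) :
    ((liftZ y y' μ : ℤ) : ZMod (P.sitesPerDir j)) = y μ - y' μ :=
  ZMod.coe_valMinAbs _

/-- kernel: the representative is minimal, 2|ỹ_μ| ≤ N. [cite: Balaban1983Higgs3, (3.16) p.437] -/
theorem two_mul_natAbs_liftZ_le (y y' : Site P j) (μ : Fin P.d) : 2 * (liftZ y y' μ).natAbs ≤ P.sitesPerDir j := by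
  have h := ZMod.natAbs_valMinAbs_le (y μ - y' μ)
  unfold liftZ
  omega

/-- kernel: the representative vanishes exactly on the diagonal. [cite: Balaban1983Higgs3, (3.16) p.437] -/
theorem liftZ_eq_zero_iff (y y' : Site P j) : liftZ y y' = 0 ↔ y = y' := by
  constructor
  · intro h
    funext μ
    have h1 := congr_fun h μ
    simp only [liftZ, Pi.zero_apply, ZMod.valMinAbs_eq_zero, sub_eq_zero] at h1
    exact h1
  · rintro rfl
    funext μ
    simp [liftZ, ZMod.valMinAbs_zero]

/-- kernel: |ỹ_μ − ỹ′_μ| is the circular distance of the coordinates. [cite: Balaban1983Higgs3, (3.16) p.437] -/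
theorem natAbs_liftZ (y y' : Site P j) (μ : Fin P.d) : (liftZ y y' μ).natAbs = cdist (y μ - y' μ) := by
  unfold liftZ
  rw [ZMod.valMinAbs_natAbs_eq_min, cdist, ZMod.neg_val]
  split_ifs with h
  · simp [h]
  · rfl

/-- kernel: simultaneous translation does not change the representative. [cite: Balaban1983Higgs3, (3.16) p.437] -/
theorem liftZ_shift_shift (y y' : Site P j) (μ : Fin P.d) : liftZ (y.shift μ) (y'.shift μ) = liftZ y y' := by
  funext ν
  simp only [liftZ]
  congr 1
  by_cases h : ν = μ
  · subst h; simp [Site.shift]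
  · simp [Site.shift, Function.update_of_ne h]

/-- **Translation invariance** "C^ξ(y − y′)": C^ξ_T(y + e_μ, y′ + e_μ) = C^ξ_T(y, y′). [cite: Balaban1983Higgs3, (3.16) p.437] -/
theorem CxiT_shift_shift (ξ : ℝ) (y y' : Site P j) (μ : Fin P.d) : CxiT ξ (y.shift μ) (y'.shift μ) = CxiT ξ y y' := by
  simp only [CxiT, liftZ_shift_shift]

/-- kernel: C^ξ_T ≥ 0. [cite: Balaban1983Higgs3, (3.16) p.437] -/
theorem CxiT_nonneg {ξ : ℝ} (hξ : 0 < ξ) (y y' : Site P j) : 0 ≤ CxiT ξ y y' := perCxi_nonneg hξ _ _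

/-- kernel: the representative of (y + e_μ) − y′ is ≡ (ỹ − ỹ′) + e_μ. [cite: Balaban1983Higgs3, (3.16) p.437] -/
theorem liftZ_shift_cast (y y' : Site P j) (μ ν : Fin P.d) :
    ((liftZ (y.shift μ) y' ν : ℤ) : ZMod (P.sitesPerDir j)) = (((liftZ y y' + unitVec μ) ν : ℤ) : ZMod (P.sitesPerDir j)) := by
  rw [liftZ_cast, Pi.add_apply, Int.cast_add, liftZ_cast, unitVec]
  by_cases h : ν = μ
  · subst h; simp [Site.shift]; ring
  · simp [Site.shift, Function.update_of_ne h, Pi.single_eq_of_ne h]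

/-- kernel: the representative of (y − e_μ) − y′ is ≡ (ỹ − ỹ′) − e_μ. [cite: Balaban1983Higgs3, (3.16) p.437] -/
theorem liftZ_unshift_cast (y y' : Site P j) (μ ν : Fin P.d) :
    ((liftZ (y.unshift μ) y' ν : ℤ) : ZMod (P.sitesPerDir j)) = (((liftZ y y' - unitVec μ) ν : ℤ) : ZMod (P.sitesPerDir j)) := by
  rw [liftZ_cast, Pi.sub_apply, Int.cast_sub, liftZ_cast, unitVec]
  by_cases h : ν = μ
  · subst h; simp [Site.unshift]; ring
  · simp [Site.unshift, Function.update_of_ne h, Pi.single_eq_of_ne h]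

/-- kernel: C^ξ_T(y + e_μ, y′) as the periodization at (ỹ − ỹ′) + e_μ. [cite: Balaban1983Higgs3, (3.16) p.437] -/
theorem CxiT_shift (ξ : ℝ) (y y' : Site P j) (μ : Fin P.d) :
    CxiT ξ (y.shift μ) y' = perCxi P.d ξ (P.sitesPerDir j) (liftZ y y' + unitVec μ) :=
  perCxi_congr ξ (liftZ_shift_cast y y' μ)

/-- kernel: C^ξ_T(y − e_μ, y′) as the periodization at (ỹ − ỹ′) − e_μ. [cite: Balaban1983Higgs3, (3.16) p.437] -/
theorem CxiT_unshift (ξ : ℝ) (y y' : Site P j) (μ : Fin P.d) :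
    CxiT ξ (y.unshift μ) y' = perCxi P.d ξ (P.sitesPerDir j) (liftZ y y' - unitVec μ) :=
  perCxi_congr ξ (liftZ_unshift_cast y y' μ)

/-- **C^ξ_T = (−Δ^ξ_T + 1)^{−1} as a kernel**: for every y′, (−Δ^ξ_T + 1)C^ξ_T(·, y′) = ξ^{−d}δ_{y′} on the torus
(`LatticeFieldCalculus.laplace ξ⁻¹` = −Δ^ξ). [cite: Balaban1983Higgs3, (3.16) p.437] -/
theorem laplace_CxiT_add {ξ : ℝ} (hξ : 0 < ξ) (y y' : Site P j) :
    laplace ξ⁻¹ (fun x => CxiT ξ x y') y + CxiT ξ y y' = if y = y' then ξ⁻¹ ^ P.d else 0 := by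
  have hN : P.sitesPerDir j ≠ 0 := P.sitesPerDir_ne_zero j
  set z := liftZ y y' with hz
  have hL : laplace ξ⁻¹ (fun x => CxiT ξ x y') y + CxiT ξ y y' =
      negLapZ ξ (perCxi P.d ξ (P.sitesPerDir j)) z + perCxi P.d ξ (P.sitesPerDir j) z := by
    simp only [laplace, negLapZ, CxiT_shift, CxiT_unshift, smul_eq_mul, ← hz]
    simp only [CxiT, ← hz]
    congr 1
    exact Finset.sum_congr rfl fun μ _ => by ring
  rw [hL, negLapZ_perCxi_add hξ hN z]
  by_cases hy : y = y'
  · subst hy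
    have hz0 : z = 0 := (liftZ_eq_zero_iff y y).2 rfl
    rw [if_pos rfl, tsum_ite_cosetPt_of_mem hN (n₀ := 0) (by simp [cosetPt, hz0])]
  · rw [if_neg hy]
    refine tsum_ite_cosetPt_of_not_mem (fun n hn => hy ?_) _
    funext μ
    have h1 : z μ + (P.sitesPerDir j : ℤ) * n μ = 0 := by
      have := congr_fun hn μ; simpa [cosetPt_apply] using this
    have h2 : ((z μ : ℤ) : ZMod (P.sitesPerDir j)) = 0 := by
      rw [show z μ = -((P.sitesPerDir j : ℤ) * n μ) by linarith]
      simp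
    rw [hz, liftZ_cast] at h2
    exact sub_eq_zero.1 h2

/-- kernel: −Δ^ξ_T of an integral operator acts on the first variable of the kernel. [cite: Balaban1983Higgs3, (3.16) p.437] -/
theorem laplace_kernelOp (c w : ℝ) (K : Kernel P j) (f : SiteField P j ℝ) (y : Site P j) :
    laplace c (kernelOp w K f) y = ∑ x' : Site P j, w * laplace c (fun x => K x x') y * f x' := by
  simp only [laplace, kernelOp, smul_eq_mul]
  symm
  calc ∑ x' : Site P j, w * (∑ μ : Fin P.d, c ^ 2 * (K y x' + K y x' - K (y.shift μ) x' - K (y.unshift μ) x')) * f x'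
      = ∑ x' : Site P j, ∑ μ : Fin P.d, w * (c ^ 2 * (K y x' + K y x' - K (y.shift μ) x' - K (y.unshift μ) x')) * f x' := by
        refine Finset.sum_congr rfl fun x' _ => ?_
        rw [Finset.mul_sum, Finset.sum_mul]
    _ = ∑ μ : Fin P.d, ∑ x' : Site P j, w * (c ^ 2 * (K y x' + K y x' - K (y.shift μ) x' - K (y.unshift μ) x')) * f x' :=
        Finset.sum_comm
    _ = ∑ μ : Fin P.d, c ^ 2 * (∑ x' : Site P j, w * K y x' * f x' + ∑ x' : Site P j, w * K y x' * f x'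
          - ∑ x' : Site P j, w * K (y.shift μ) x' * f x' - ∑ x' : Site P j, w * K (y.unshift μ) x' * f x') := by
        refine Finset.sum_congr rfl fun μ _ => ?_
        rw [← Finset.sum_add_distrib, ← Finset.sum_sub_distrib, ← Finset.sum_sub_distrib, Finset.mul_sum]
        exact Finset.sum_congr rfl fun x' _ => by ring

/-- **C^ξ_T = (−Δ^ξ_T + 1)^{−1} as an operator**: for the integral operator C f = Σ_{y′} ξ^d C^ξ_T(·, y′) f(y′),
(−Δ^ξ_T)(Cf) + Cf = f for every f — the hypothesis `hC` of p20's `B3Sect3ScalarSelfEnergy.eq316_sum_pdiff`.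
[cite: Balaban1983Higgs3, (3.16) p.437] -/
theorem laplace_kernelOp_CxiT_add {ξ : ℝ} (hξ : 0 < ξ) (f : SiteField P j ℝ) :
    laplace ξ⁻¹ (kernelOp (ξ ^ P.d) (CxiT ξ) f) + kernelOp (ξ ^ P.d) (CxiT ξ) f = f := by
  funext y
  rw [Pi.add_apply, laplace_kernelOp, kernelOp, ← Finset.sum_add_distrib]
  have h : ∀ x' : Site P j, ξ ^ P.d * laplace ξ⁻¹ (fun x => CxiT ξ x x') y * f x' + ξ ^ P.d * CxiT ξ y x' * f x' =
      if y = x' then f x' else 0 := by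
    intro x'
    rw [← add_mul, ← mul_add, laplace_CxiT_add hξ y x']
    split_ifs
    · rw [← mul_pow, mul_inv_cancel₀ hξ.ne', one_pow, one_mul]
    · rw [mul_zero, zero_mul]
  simp_rw [h]
  rw [Finset.sum_ite_eq]
  simp

end Torus

/-! ## 3. The bound on the three-dimensional torus -/

section Bound

variable {d : ℕ}

/-- the sup norm |z|_∞ of an integer site (real-valued), any dimension. [cite: Balaban1983Higgs3, (3.16) p.437] -/
def supZ (z : ZSite d) : ℝ := ((Finset.univ.sup fun μ : Fin d => (z μ).natAbs : ℕ) : ℝ)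

/-- kernel: in d = 3 this is `B3CxiComparisonBound.supn`. [cite: Balaban1983Higgs3, (3.16) p.437] -/
theorem supZ_three (z : ZSite 3) : supZ z = supn z := rfl

/-- kernel: each coordinate is within the sup norm. [cite: Balaban1983Higgs3, (3.16) p.437] -/
theorem natAbs_le_supZ (z : ZSite d) (μ : Fin d) : ((z μ).natAbs : ℝ) ≤ supZ z := by
  unfold supZ
  exact_mod_cast Finset.le_sup (f := fun μ : Fin d => (z μ).natAbs) (Finset.mem_univ μ)

/-- kernel: monotonicity of the sup norm in the coordinates. [cite: Balaban1983Higgs3, (3.16) p.437] -/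
theorem supZ_mono {z x : ZSite d} (h : ∀ μ, (z μ).natAbs ≤ (x μ).natAbs) : supZ z ≤ supZ x := by
  unfold supZ
  exact_mod_cast Finset.sup_mono_fun (s := Finset.univ) fun μ _ => h μ

/-- kernel: a coordinatewise bound bounds the sup norm. [cite: Balaban1983Higgs3, (3.16) p.437] -/
theorem two_mul_supZ_le {z : ZSite d} {N : ℕ} (h : ∀ μ, 2 * (z μ).natAbs ≤ N) : 2 * supZ z ≤ N := by
  unfold supZ
  have h1 : (Finset.univ.sup fun μ : Fin d => (z μ).natAbs) ≤ N / 2 :=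
    Finset.sup_le fun μ _ => by have := h μ; omega
  have h2 : 2 * (Finset.univ.sup fun μ : Fin d => (z μ).natAbs) ≤ N := by omega
  exact_mod_cast h2

/-- kernel: the circular sup distance of the torus is the sup norm of the minimal representative.
[cite: Balaban1983Higgs3, (3.16) p.437] -/
theorem supDist_eq_supZ {P : Params} {j : ℕ} (y y' : Site P j) : (supDist y y' : ℝ) = supZ (liftZ y y') := by
  unfold supZ
  rw [supDist_eq_sup_cdist]
  congr 1
  exact Finset.sup_congr rfl fun μ _ => (natAbs_liftZ y y' μ).symm

/-- **The coset term bound** (d = 3, 0 < ξ ≤ 1): for z ≠ 0 with 2|z_μ| ≤ N and any n ∈ ℤ³,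
C^ξ(z + N·n) ≤ A·(e^{−½ξ|z|_∞}/(ξ|z|_∞))·Π_μ q^{(|n_μ|−1)⁺}, q = e^{−ξN/6} (from `abs_Cxi_le_yukawa_sup` at z + N·n, whose sup norm
is ≥ |z|_∞ + N(|n_μ| − 1) for n_μ ≠ 0). [cite: Balaban1983Higgs3, (3.16) p.437] -/
theorem Cxi_cosetPt_le {ξ : ℝ} (hξ : 0 < ξ) (hξ1 : ξ ≤ 1) {N : ℕ} {z : ZSite 3} (hz : z ≠ 0)
    (hzN : ∀ μ, 2 * (z μ).natAbs ≤ N) (n : ZSite 3) :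
    Cxi 3 ξ (cosetPt N z n) ≤ cmpConst * (Real.exp (-(1 / 2 * (ξ * supn z))) / (ξ * supn z)) *
      ∏ μ : Fin 3, Real.exp (-(ξ * N / 6)) ^ ((n μ).natAbs - 1) := by
  set x := cosetPt N z n with hx
  -- the triangle inequality N|n_μ| ≤ |x_μ| + |z_μ| in every direction
  have htri : ∀ μ : Fin 3, N * (n μ).natAbs ≤ (x μ).natAbs + (z μ).natAbs := by
    intro μ
    have h1 : ((N : ℤ) * n μ).natAbs = N * (n μ).natAbs := by rw [Int.natAbs_mul, Int.natAbs_natCast]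
    have h2 := Int.natAbs_sub_le (x μ) (z μ)
    rw [hx, cosetPt_apply, add_sub_cancel_left, h1] at h2
    rw [hx, cosetPt_apply]
    exact h2
  -- (0) x ≠ 0
  have hx0 : x ≠ 0 := by
    intro h0
    apply hz
    funext μ
    have h1 : (x μ).natAbs = 0 := by rw [h0]; rfl
    have h2 := hzN μ
    have h3 := htri μ
    rw [h1, zero_add] at h3
    by_cases hn : n μ = 0
    · have : x μ = z μ := by rw [hx, cosetPt_apply, hn, mul_zero, add_zero]
      rw [← this]; exact Int.natAbs_eq_zero.1 h1
    · have h4 : 1 ≤ (n μ).natAbs := Int.natAbs_pos.2 hn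
      have h5 : N ≤ N * (n μ).natAbs := Nat.le_mul_of_pos_right N h4
      have h6 : (z μ).natAbs = 0 := by omega
      exact Int.natAbs_eq_zero.1 h6
  -- (1) |z_μ| ≤ |x_μ|
  have hcoord : ∀ μ : Fin 3, (z μ).natAbs ≤ (x μ).natAbs := by
    intro μ
    by_cases hn : n μ = 0
    · have : x μ = z μ := by rw [hx, cosetPt_apply, hn, mul_zero, add_zero]
      rw [this]
    · have h4 : 1 ≤ (n μ).natAbs := Int.natAbs_pos.2 hn
      have h5 : N ≤ N * (n μ).natAbs := Nat.le_mul_of_pos_right N h4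
      have h2 := hzN μ
      have h3 := htri μ
      omega
  have hsz : supn z ≤ supn x := by rw [← supZ_three, ← supZ_three]; exact supZ_mono hcoord
  have hszN : 2 * supn z ≤ N := by rw [← supZ_three]; exact two_mul_supZ_le hzN
  -- (2) the gain N(|n_μ| − 1)⁺ in every direction
  have hgap : ∀ μ : Fin 3, (N : ℝ) * (((n μ).natAbs - 1 : ℕ) : ℝ) ≤ supn x - supn z := by
    intro μ
    by_cases hk : (n μ).natAbs = 0
    · rw [hk]; simp; linarith
    · have hk1 : 1 ≤ (n μ).natAbs := Nat.one_le_iff_ne_zero.2 hk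
      rw [Nat.cast_sub hk1, Nat.cast_one]
      have h6 : (N : ℝ) * (n μ).natAbs ≤ (x μ).natAbs + (z μ).natAbs := by exact_mod_cast htri μ
      have h8 : ((x μ).natAbs : ℝ) ≤ supn x := by rw [← supZ_three]; exact natAbs_le_supZ x μ
      have h9 : ((z μ).natAbs : ℝ) ≤ supn z := by rw [← supZ_three]; exact natAbs_le_supZ z μ
      nlinarith
  -- (3) the exponential factor
  have hexp : Real.exp (-(1 / 2 * (ξ * supn x))) ≤
      Real.exp (-(1 / 2 * (ξ * supn z))) * ∏ μ : Fin 3, Real.exp (-(ξ * N / 6)) ^ ((n μ).natAbs - 1) := by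
    have hprod : ∏ μ : Fin 3, Real.exp (-(ξ * N / 6)) ^ ((n μ).natAbs - 1) =
        Real.exp (∑ μ : Fin 3, (((n μ).natAbs - 1 : ℕ) : ℝ) * (-(ξ * N / 6))) := by
      rw [Real.exp_sum]
      exact Finset.prod_congr rfl fun μ _ => (Real.exp_nat_mul _ _).symm
    rw [hprod, ← Real.exp_add]
    apply Real.exp_le_exp.2
    have hsum : (N : ℝ) * ∑ μ : Fin 3, (((n μ).natAbs - 1 : ℕ) : ℝ) ≤ 3 * (supn x - supn z) := by
      rw [Finset.mul_sum]
      calc ∑ μ : Fin 3, (N : ℝ) * (((n μ).natAbs - 1 : ℕ) : ℝ) ≤ ∑ _μ : Fin 3, (supn x - supn z) :=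
            Finset.sum_le_sum fun μ _ => hgap μ
        _ = 3 * (supn x - supn z) := by
            rw [Finset.sum_const, Finset.card_univ, Fintype.card_fin, nsmul_eq_mul]; norm_num
    have hre : ∑ μ : Fin 3, (((n μ).natAbs - 1 : ℕ) : ℝ) * (-(ξ * N / 6)) =
        -(ξ / 6) * ((N : ℝ) * ∑ μ : Fin 3, (((n μ).natAbs - 1 : ℕ) : ℝ)) := by
      rw [Finset.mul_sum, Finset.mul_sum]
      exact Finset.sum_congr rfl fun μ _ => by ring
    rw [hre]
    nlinarith [mul_le_mul_of_nonneg_left hsum hξ.le]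
  -- (4) assemble
  have hA := abs_Cxi_le_yukawa_sup hξ hξ1 hx0
  have hzpos : 0 < supn z := lt_of_lt_of_le one_pos (one_le_supn hz)
  have hξz : 0 < ξ * supn z := mul_pos hξ hzpos
  calc Cxi 3 ξ x ≤ |Cxi 3 ξ x| := le_abs_self _
    _ ≤ cmpConst * (Real.exp (-(1 / 2 * (ξ * supn x))) / (ξ * supn x)) := hA
    _ ≤ cmpConst * ((Real.exp (-(1 / 2 * (ξ * supn z))) *
          ∏ μ : Fin 3, Real.exp (-(ξ * N / 6)) ^ ((n μ).natAbs - 1)) / (ξ * supn z)) :=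
        mul_le_mul_of_nonneg_left (div_le_div₀ (by positivity) hexp hξz (mul_le_mul_of_nonneg_left hsz hξ.le))
          cmpConst_pos.le
    _ = _ := by ring

/-- kernel: Σ_{k ∈ T} q^{(|k|−1)⁺} ≤ 1 + 2/(1 − q) for every finite T ⊂ ℤ, 0 ≤ q < 1. [folklore] -/
private theorem sum_pow_natAbs_le {q : ℝ} (hq : 0 ≤ q) (hq1 : q < 1) (T : Finset ℤ) :
    ∑ k ∈ T, q ^ (k.natAbs - 1) ≤ 1 + 2 / (1 - q) := by
  set g : ℤ → ℝ := fun k => q ^ (k.natAbs - 1) with hg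
  have h1 : HasSum (fun m : ℕ => g m) ((1 - q)⁻¹ + 1) := by
    have hs : HasSum (fun m : ℕ => g ((m + 1 : ℕ) : ℤ)) (1 - q)⁻¹ := by
      have e : ∀ m : ℕ, g ((m + 1 : ℕ) : ℤ) = q ^ m := by
        intro m; simp only [hg, Int.natAbs_natCast, Nat.add_sub_cancel]
      simp_rw [e]
      exact hasSum_geometric_of_lt_one hq hq1
    have h := (hasSum_nat_add_iff (f := fun m : ℕ => g m) 1).1 hs
    simpa [hg] using h
  have h2 : HasSum (fun m : ℕ => g (-(m + 1))) (1 - q)⁻¹ := by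
    have e : ∀ m : ℕ, g (-(m + 1)) = q ^ m := fun m => rfl
    simp_rw [e]
    exact hasSum_geometric_of_lt_one hq hq1
  have h := HasSum.of_nat_of_neg_add_one h1 h2
  calc ∑ k ∈ T, q ^ (k.natAbs - 1) = ∑ k ∈ T, g k := rfl
    _ ≤ (1 - q)⁻¹ + 1 + (1 - q)⁻¹ := sum_le_hasSum T (fun k _ => pow_nonneg hq _) h
    _ = 1 + 2 / (1 - q) := by ring

/-- kernel: Σ_{n ∈ F} Π_μ q^{(|n_μ|−1)⁺} ≤ (1 + 2/(1 − q))^d for every finite F ⊂ ℤ^d (product structure).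
[cite: Balaban1983Higgs3, (3.16) p.437] -/
theorem sum_prod_le {q : ℝ} (hq : 0 ≤ q) (hq1 : q < 1) (F : Finset (ZSite d)) :
    ∑ n ∈ F, ∏ μ : Fin d, q ^ ((n μ).natAbs - 1) ≤ (1 + 2 / (1 - q)) ^ d := by
  classical
  set T : Finset ℤ := F.biUnion fun n => Finset.univ.image n with hT
  have hsub : F ⊆ Fintype.piFinset fun _ : Fin d => T := by
    intro n hn
    rw [Fintype.mem_piFinset]
    intro μ
    rw [hT, Finset.mem_biUnion]
    exact ⟨n, hn, Finset.mem_image_of_mem _ (Finset.mem_univ μ)⟩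
  calc ∑ n ∈ F, ∏ μ : Fin d, q ^ ((n μ).natAbs - 1)
      ≤ ∑ n ∈ Fintype.piFinset (fun _ : Fin d => T), ∏ μ : Fin d, q ^ ((n μ).natAbs - 1) :=
        Finset.sum_le_sum_of_subset_of_nonneg hsub fun n _ _ => Finset.prod_nonneg fun μ _ => pow_nonneg hq _
    _ = ∏ _μ : Fin d, ∑ k ∈ T, q ^ (k.natAbs - 1) :=
        (Finset.prod_univ_sum (fun _ : Fin d => T) (fun _ k => q ^ (k.natAbs - 1))).symm
    _ = (∑ k ∈ T, q ^ (k.natAbs - 1)) ^ d := by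
        rw [Finset.prod_const, Finset.card_univ, Fintype.card_fin]
    _ ≤ (1 + 2 / (1 - q)) ^ d :=
        pow_le_pow_left₀ (Finset.sum_nonneg fun k _ => pow_nonneg hq _) (sum_pow_natAbs_le hq hq1 T) d

/-- The torus constant A_T = A·(1 + 2/(1 − e^{−1/6}))³ (A = `cmpConst`): the printed "O(1)" for the periodic propagator,
independent of ξ ≤ 1 and of the torus with ξN ≥ 1. [cite: Balaban1983Higgs3, (3.16) p.437] -/
def torusConst : ℝ := cmpConst * (1 + 2 / (1 - Real.exp (-(1 / 6)))) ^ 3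

/-- kernel: e^{−1/6} < 1. [folklore] -/
private theorem exp_neg_sixth_lt_one : Real.exp (-(1 / 6)) < 1 := by
  have h := Real.exp_lt_exp.2 (show (-(1 / 6) : ℝ) < 0 by norm_num)
  rwa [Real.exp_zero] at h

/-- kernel: A_T ≥ 0. [cite: Balaban1983Higgs3, (3.16) p.437] -/
theorem torusConst_nonneg : 0 ≤ torusConst := by
  have h := exp_neg_sixth_lt_one
  unfold torusConst
  have : 0 ≤ 1 + 2 / (1 - Real.exp (-(1 / 6))) := by
    have : 0 < 1 - Real.exp (-(1 / 6)) := by linarith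
    positivity
  exact mul_nonneg cmpConst_pos.le (pow_nonneg this 3)

/-- **The periodization bound** (d = 3): for 0 < ξ ≤ 1, ξN ≥ 1, z ≠ 0 minimal (2|z_μ| ≤ N),
Σ'_n C^ξ(z + N·n) ≤ A_T·e^{−½ξ|z|_∞}/(ξ|z|_∞). [cite: Balaban1983Higgs3, (3.16) p.437] -/
theorem perCxi_le {d : ℕ} (hd : d = 3) {ξ : ℝ} (hξ : 0 < ξ) (hξ1 : ξ ≤ 1) {N : ℕ} (hN : 1 ≤ ξ * N)
    {z : ZSite d} (hz : z ≠ 0) (hzN : ∀ μ, 2 * (z μ).natAbs ≤ N) :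
    perCxi d ξ N z ≤ torusConst * (Real.exp (-(1 / 2 * (ξ * supZ z))) / (ξ * supZ z)) := by
  subst hd
  rw [supZ_three]
  set q : ℝ := Real.exp (-(ξ * N / 6)) with hq
  have hq0 : 0 ≤ q := (Real.exp_pos _).le
  have hq1 : q ≤ Real.exp (-(1 / 6)) := Real.exp_le_exp.2 (by linarith)
  have hq1' : q < 1 := lt_of_le_of_lt hq1 exp_neg_sixth_lt_one
  have hzpos : 0 < supn z := lt_of_lt_of_le one_pos (one_le_supn hz)
  set B : ℝ := cmpConst * (Real.exp (-(1 / 2 * (ξ * supn z))) / (ξ * supn z)) with hB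
  have hB0 : 0 ≤ B := by
    have := cmpConst_pos
    positivity
  have hS0 : 0 ≤ 1 + 2 / (1 - q) := by
    have : 0 < 1 - q := by linarith
    positivity
  have hS : (1 + 2 / (1 - q)) ^ 3 ≤ (1 + 2 / (1 - Real.exp (-(1 / 6)))) ^ 3 := by
    refine pow_le_pow_left₀ hS0 ?_ 3
    have h1 : 0 < 1 - Real.exp (-(1 / 6)) := by linarith [exp_neg_sixth_lt_one]
    have h2 : 2 / (1 - q) ≤ 2 / (1 - Real.exp (-(1 / 6))) :=
      div_le_div_of_nonneg_left (by norm_num) h1 (by linarith)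
    linarith
  have hF : ∀ F : Finset (ZSite 3), ∑ n ∈ F, Cxi 3 ξ (cosetPt N z n) ≤ B * (1 + 2 / (1 - q)) ^ 3 := by
    intro F
    calc ∑ n ∈ F, Cxi 3 ξ (cosetPt N z n)
        ≤ ∑ n ∈ F, B * ∏ μ : Fin 3, q ^ ((n μ).natAbs - 1) :=
          Finset.sum_le_sum fun n _ => Cxi_cosetPt_le hξ hξ1 hz hzN n
      _ = B * ∑ n ∈ F, ∏ μ : Fin 3, q ^ ((n μ).natAbs - 1) := by rw [Finset.mul_sum]
      _ ≤ B * (1 + 2 / (1 - q)) ^ 3 := mul_le_mul_of_nonneg_left (sum_prod_le hq0 hq1' F) hB0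
  calc perCxi 3 ξ N z = ∑' n : ZSite 3, Cxi 3 ξ (cosetPt N z n) := rfl
    _ ≤ B * (1 + 2 / (1 - q)) ^ 3 := tsum_le_of_sum_le' (mul_nonneg hB0 (pow_nonneg hS0 3)) hF
    _ ≤ B * (1 + 2 / (1 - Real.exp (-(1 / 6)))) ^ 3 := mul_le_mul_of_nonneg_left hS hB0
    _ = torusConst * (Real.exp (-(1 / 2 * (ξ * supn z))) / (ξ * supn z)) := by
        simp only [torusConst, hB]; ring

variable {P : Params} {j : ℕ}

/-- **[Balaban1983Higgs3] p. 437, |C^ξ(y − y′)| ≦ O(1)e^{−½|y−y′|}/|y − y′| ON THE TORUS — PROVED** (d = 3, 0 < ξ ≤ 1, physical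
period ξN ≥ 1, y′ ≠ y): |C^ξ_T(y, y′)| ≤ A_T·(ξ|y − y′|_∞)^{−1}·e^{−½·ξ|y − y′|_∞} with |y − y′|_∞ = `supDist y y′` lattice steps,
A_T = `torusConst` independent of ξ and of the torus. [cite: Balaban1983Higgs3, (3.16) p.437] -/
theorem abs_CxiT_le (hd : P.d = 3) {ξ : ℝ} (hξ : 0 < ξ) (hξ1 : ξ ≤ 1) (hN : 1 ≤ ξ * (P.sitesPerDir j : ℝ))
    {y y' : Site P j} (hne : y' ≠ y) :
    |CxiT ξ y y'| ≤ torusConst * (ξ * (supDist y y' : ℝ))⁻¹ * Real.exp (-(1 / 2 * (ξ * (supDist y y' : ℝ)))) := by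
  rw [abs_of_nonneg (CxiT_nonneg hξ y y')]
  have hz : liftZ y y' ≠ 0 := fun h => hne ((liftZ_eq_zero_iff y y').1 h).symm
  have h := perCxi_le hd hξ hξ1 hN hz (two_mul_natAbs_liftZ_le y y')
  rw [← supDist_eq_supZ] at h
  calc CxiT ξ y y' = perCxi P.d ξ (P.sitesPerDir j) (liftZ y y') := rfl
    _ ≤ _ := h
    _ = _ := by ring

/-- **The hypothesis `hC` of `B3Bound316.abs_bracket316_le` for the actual free propagator of the torus** (δ = ½,
A = `torusConst`): the torus member of the printed C^ξ-inequality in the exact shape consumed downstream.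
[cite: Balaban1983Higgs3, (3.16) p.437] -/
theorem CxiT_hC (hd : P.d = 3) {ξ : ℝ} (hξ : 0 < ξ) (hξ1 : ξ ≤ 1) (hN : 1 ≤ ξ * (P.sitesPerDir j : ℝ)) :
    ∀ y y' : Site P j, y' ≠ y →
      |CxiT ξ y y'| ≤ torusConst * (ξ * (supDist y y' : ℝ))⁻¹ * Real.exp (-(1 / 2 * (ξ * (supDist y y' : ℝ)))) :=
  fun _ _ hne => abs_CxiT_le hd hξ hξ1 hN hne

end Bound

/-! ## 4. Symmetry, unit mass and the zero mode of the torus propagator (v1.1) -/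

section Mass

variable {d : ℕ}

/-- kernel: the periodization is even (C^ξ is even, r15's `Cxi_neg`). [cite: Balaban1983Higgs3, (3.16) p.437] -/
theorem perCxi_neg (ξ : ℝ) (N : ℕ) (z : ZSite d) : perCxi d ξ N (-z) = perCxi d ξ N z := by
  unfold perCxi
  have h : ∀ n, cosetPt N (-z) n = -(cosetPt N z (-n)) := by
    intro n; simp only [cosetPt, smul_neg]; abel
  simp_rw [h, Cxi_neg]
  exact (Equiv.neg (ZSite d)).tsum_eq (fun n => Cxi d ξ (cosetPt N z n))

variable {P : Params} {j : ℕ}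

/-- kernel: the representative of y′ − y is ≡ −(ỹ − ỹ′). [cite: Balaban1983Higgs3, (3.16) p.437] -/
theorem liftZ_swap_cast (y y' : Site P j) (μ : Fin P.d) :
    ((liftZ y' y μ : ℤ) : ZMod (P.sitesPerDir j)) = (((-liftZ y y') μ : ℤ) : ZMod (P.sitesPerDir j)) := by
  rw [liftZ_cast, Pi.neg_apply, Int.cast_neg, liftZ_cast, neg_sub]

/-- **Symmetry** C^ξ_T(y, y′) = C^ξ_T(y′, y). [cite: Balaban1983Higgs3, (3.16) p.437] -/
theorem CxiT_symm (ξ : ℝ) (y y' : Site P j) : CxiT ξ y y' = CxiT ξ y' y := by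
  have h : CxiT ξ y' y = perCxi P.d ξ (P.sitesPerDir j) (-liftZ y y') := perCxi_congr ξ (liftZ_swap_cast y y')
  rw [h, perCxi_neg]
  rfl

/-- kernel: (y′, n) ↦ (ỹ − ỹ′) + N·n is a bijection of T × ℤ^d onto ℤ^d (every integer site has exactly one residue class
representative and one period shift). [cite: Balaban1983Higgs3, (3.16) p.437] -/
theorem cosetPt_liftZ_bijective (y : Site P j) :
    Function.Bijective fun p : Site P j × ZSite P.d => cosetPt (P.sitesPerDir j) (liftZ y p.1) p.2 := by
  have hN : P.sitesPerDir j ≠ 0 := P.sitesPerDir_ne_zero j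
  constructor
  · rintro ⟨y₁, n₁⟩ ⟨y₂, n₂⟩ h
    simp only at h
    have hy : y₁ = y₂ := by
      funext μ
      have h1 := congr_arg (fun z : ZSite P.d => ((z μ : ℤ) : ZMod (P.sitesPerDir j))) h
      simp only [cosetPt_apply, Int.cast_add, Int.cast_mul, Int.cast_natCast, ZMod.natCast_self, zero_mul, add_zero,
        liftZ_cast] at h1
      exact sub_right_injective h1
    subst hy
    have hn := cosetPt_injective hN _ h
    rw [hn]
  · intro x
    set y' : Site P j := fun μ => y μ - ((x μ : ℤ) : ZMod (P.sitesPerDir j)) with hy'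
    have hw : ∀ μ, ∃ w : ℤ, x μ = liftZ y y' μ + P.sitesPerDir j * w := by
      intro μ
      have hc : ((liftZ y y' μ : ℤ) : ZMod (P.sitesPerDir j)) = ((x μ : ℤ) : ZMod (P.sitesPerDir j)) := by
        rw [liftZ_cast, hy']
        simp
      obtain ⟨w, hw⟩ := (ZMod.intCast_eq_intCast_iff_dvd_sub (liftZ y y' μ) (x μ) _).1 hc
      exact ⟨w, by linarith⟩
    choose w hw using hw
    refine ⟨(y', fun μ => w μ), ?_⟩
    funext μ
    simp only [cosetPt_apply]
    linarith [hw μ]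

/-- **Unit mass on the torus**: Σ_{y′} ξ^d C^ξ_T(y, y′) = 1, i.e. (−Δ^ξ_T + 1)^{−1}1 = 1 (from r15's `tsum_Cxi` on ξℤ^d by the
bijection `cosetPt_liftZ_bijective`). [cite: Balaban1983Higgs3, (3.16) p.437] -/
theorem sum_mul_CxiT {ξ : ℝ} (hξ : 0 < ξ) (y : Site P j) : ∑ y' : Site P j, ξ ^ P.d * CxiT ξ y y' = 1 := by
  have hN : P.sitesPerDir j ≠ 0 := P.sitesPerDir_ne_zero j
  set e : Site P j × ZSite P.d ≃ ZSite P.d := Equiv.ofBijective _ (cosetPt_liftZ_bijective y) with he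
  have hs : Summable (Cxi P.d ξ ∘ e) := e.summable_iff.2 (summable_Cxi hξ)
  have h1 : ∑' p : Site P j × ZSite P.d, Cxi P.d ξ (e p) = ∑' x, Cxi P.d ξ x := e.tsum_eq (Cxi P.d ξ)
  have h2 : ∑' p : Site P j × ZSite P.d, Cxi P.d ξ (e p) =
      ∑' (y' : Site P j) (n : ZSite P.d), Cxi P.d ξ (e (y', n)) :=
    hs.tsum_prod' fun y' => summable_coset hξ hN (liftZ y y')
  have h3 : ∑' y' : Site P j, ∑' n : ZSite P.d, Cxi P.d ξ (e (y', n)) =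
      ∑ y' : Site P j, ∑' n : ZSite P.d, Cxi P.d ξ (e (y', n)) := tsum_fintype _
  calc ∑ y' : Site P j, ξ ^ P.d * CxiT ξ y y' = ξ ^ P.d * ∑ y' : Site P j, ∑' n : ZSite P.d, Cxi P.d ξ (e (y', n)) := by
        rw [Finset.mul_sum]; rfl
    _ = ξ ^ P.d * ∑' x, Cxi P.d ξ x := by rw [← h3, ← h2, h1]
    _ = 1 := by rw [← tsum_mul_left]; exact tsum_Cxi hξ

/-- **The zero mode**: for every y some entry satisfies C^ξ_T(y, y′) ≥ (ξN)^{−d} (average of `sum_mul_CxiT` over the N^d sites)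
— the reason the uniform bound `CxiT_hC` carries the hypothesis 1 ≤ ξN. [cite: Balaban1983Higgs3, (3.16) p.437] -/
theorem exists_CxiT_ge {ξ : ℝ} (hξ : 0 < ξ) (y : Site P j) :
    ∃ y' : Site P j, ((ξ * P.sitesPerDir j) ^ P.d)⁻¹ ≤ CxiT ξ y y' := by
  classical
  have hN : (0 : ℝ) < P.sitesPerDir j := by exact_mod_cast Nat.pos_of_ne_zero (P.sitesPerDir_ne_zero j)
  have hcard : (Finset.univ : Finset (Site P j)).card = P.sitesPerDir j ^ P.d := by
    rw [Finset.card_univ]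
    show Fintype.card (Fin P.d → ZMod (P.sitesPerDir j)) = _
    simp [Fintype.card_pi, ZMod.card, Finset.prod_const]
  have hone : ((P.sitesPerDir j : ℝ) ^ P.d) * (((ξ * P.sitesPerDir j) ^ P.d)⁻¹ * ξ ^ P.d) = 1 := by
    rw [mul_pow]
    field_simp
  have hsum : ∑ _y' : Site P j, ((ξ * P.sitesPerDir j) ^ P.d)⁻¹ * ξ ^ P.d ≤ ∑ y' : Site P j, CxiT ξ y y' * ξ ^ P.d := by
    have h1 : ∑ y' : Site P j, CxiT ξ y y' * ξ ^ P.d = 1 := by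
      rw [← sum_mul_CxiT hξ y]
      exact Finset.sum_congr rfl fun y' _ => mul_comm _ _
    rw [h1, Finset.sum_const, hcard, nsmul_eq_mul, Nat.cast_pow, hone]
  obtain ⟨y', -, h⟩ := Finset.exists_le_of_sum_le Finset.univ_nonempty hsum
  exact ⟨y', le_of_mul_le_mul_right h (pow_pos hξ _)⟩

end Mass

end

end Literature.MathematicalPhysics.QuantumFieldTheory.Balaban1983to89.B3CxiTorusBound
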